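import Literature.Algebra.Lie.KatzRecognitionTheorems
import Literature.Algebra.Lie.SymplecticSymmetricSquares
import Literature.Algebra.Lie.InvariantFormsOfIrreducible
import HarnessLib

/-!
# BL, case (a): an irreducible semisimple `𝔤 ≤ 𝔰𝔭(M, ω)` containing a transvection direction `s_{vv}` is `𝔰𝔭(M, ω)`
(over Katz's Theorem 1.5: the unipotent pseudo-reflection `1 + s_{vv}` normalises `𝔤`)

* `conj_one_add_eq` — for `N² = 0`: `(1 + N) X (1 − N) = X + [N, X] − N X N` and `N X N = −½ [N, [N, X]]`, so a Lie subalgebra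
  containing `N` is normalised by the unipotent `1 + N` (`conj_mem_of_sq_zero_mem`, with `unipotentEquiv N` the unit `1 + N`);
* `symSq_self_mul_self` — `s_{vv}² = 0`; `finrank_range_symSq_self` — `rank s_{vv} = 1` (`ω` non-degenerate, `v ≠ 0`, `2 ≠ 0`);
* `not_isSL_of_skew` — a Lie algebra of `ω`-skew operators is not `𝒮ℒ(M)` once `M` carries two orthogonal hyperbolic pairs
  (the trace-zero operator `ω(·, w) v − ω(·, u′) u` is not skew);
* **`eq_skewAdjoint_of_symSq_self_mem`** — `K` algebraically closed of characteristic `0`; `L ≤ 𝔰𝔭(M, ω)` irreducible and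
  semisimple with `s_{vv} ∈ L`, `v ≠ 0`; given `Katz1990_thm15_pseudoreflection`: `L = 𝔰𝔭(M, ω)` (1.5 gives `𝒮ℒ ∨ 𝒮𝒪 ∨ 𝒮𝒫`;
  `𝒮ℒ` is excluded by `not_isSL_of_skew`, `𝒮𝒪` by `InvariantForms.not_symm_invariant_of_le_sp`, and `𝒮𝒫` upgrades by
  `InvariantForms.eq_skewAdjoint_of_eq_skewAdjoint_of_le`).
THEOREMS (+ the explicit unit `unipotentEquiv`); for the Hodge cell's crux K1Q. [cite: Katz1990ESDE, Ch. 1, Thm. 1.5 (p. 11) and (1.7.6)]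
-/

namespace Literature.Algebra.Lie

-- Mathlib's own non-instance `def` for the commutator bracket on an associative ring, enabled LOCALLY exactly as
-- `Mathlib.Algebra.Lie.SkewAdjoint` and the tree's `KatzRecognitionTheorems` do.
attribute [local instance 100] LieRing.ofAssociativeRing

namespace TransvectionDirection

open Module KatzRecognition SymplecticSymmetricSquares InvariantForms
open LinearMap (BilinForm)

variable {K : Type*} [Field K] {V : Type*} [AddCommGroup V] [Module K V]

/-! ## The unipotent `1 + N` of a square-zero `N` normalises every Lie subalgebra containing `N` -/

/-- The unit `1 + N` (`N² = 0`) as a linear automorphism, with inverse `1 − N`. [cite: Katz1990ESDE, Ch. 1, (1.7.6) (p. 22)] -/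
def unipotentEquiv (N : Module.End K V) (hN : N * N = 0) : V ≃ₗ[K] V :=
  LinearEquiv.ofLinear (1 + N) (1 - N)
    (by rw [← Module.End.mul_eq_comp, add_mul, mul_sub, mul_sub, one_mul, mul_one, one_mul, hN]; abel)
    (by rw [← Module.End.mul_eq_comp, sub_mul, mul_add, mul_add, one_mul, mul_one, one_mul, hN]; abel)

/-- `unipotentEquiv N = 1 + N` as an endomorphism. [cite: Katz1990ESDE, Ch. 1, (1.7.6) (p. 22)] -/
theorem coe_unipotentEquiv (N : Module.End K V) (hN : N * N = 0) :
    (unipotentEquiv N hN : V →ₗ[K] V) = 1 + N := rfl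

/-- `(unipotentEquiv N)⁻¹ = 1 − N` as an endomorphism. [cite: Katz1990ESDE, Ch. 1, (1.7.6) (p. 22)] -/
theorem coe_unipotentEquiv_symm (N : Module.End K V) (hN : N * N = 0) :
    ((unipotentEquiv N hN).symm : V →ₗ[K] V) = 1 - N := rfl

/-- `rank((1 + N) − 1) = rank N`. [cite: Katz1990ESDE, Ch. 1, (1.7.6) (p. 22)] -/
theorem unipotentEquiv_sub_id (N : Module.End K V) (hN : N * N = 0) :
    (unipotentEquiv N hN : V →ₗ[K] V) - LinearMap.id = N := by
  rw [coe_unipotentEquiv]; exact add_sub_cancel_left 1 N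

/-- **`(1 + N) X (1 − N) = X + [N, X] − N X N` and `−N X N = ½ [N, [N, X]]`** for `N² = 0`, in the form: `2 (1+N) X (1−N) =
2 X + 2 [N, X] + [N, [N, X]]`. [cite: Katz1990ESDE, Ch. 1, (1.7.6) (p. 22)] -/
theorem two_smul_conj_one_add_eq (N X : Module.End K V) (hN : N * N = 0) :
    (2 : K) • ((1 + N) * X * (1 - N)) = (2 : K) • X + (2 : K) • ⁅N, X⁆ + ⁅N, ⁅N, X⁆⁆ := by
  simp only [LieRing.of_associative_ring_bracket, two_smul]
  have h1 : N * (N * X) = 0 := by rw [← mul_assoc, hN, zero_mul]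
  have h2 : X * N * N = 0 := by rw [mul_assoc, hN, mul_zero]
  have e : (1 + N) * X * (1 - N) = X + N * X - X * N - N * X * N := by noncomm_ring
  have e2 : N * (N * X - X * N) - (N * X - X * N) * N = -(N * X * N) - N * X * N := by
    rw [mul_sub, sub_mul, h1, h2, ← mul_assoc]; abel
  rw [e, e2]
  abel

/-- **A Lie subalgebra containing a square-zero `N` is normalised by `1 + N`** (`2 ≠ 0`).
[cite: Katz1990ESDE, Ch. 1, (1.7.6) (p. 22)] -/
theorem conj_mem_of_sq_zero_mem (h2 : (2 : K) ≠ 0) (L : LieSubalgebra K (Module.End K V)) {N : Module.End K V}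
    (hN : N * N = 0) (hNL : N ∈ L) {X : Module.End K V} (hX : X ∈ L) :
    (unipotentEquiv N hN : V →ₗ[K] V) * X * ((unipotentEquiv N hN).symm : V →ₗ[K] V) ∈ L := by
  rw [coe_unipotentEquiv, coe_unipotentEquiv_symm]
  have hmem : (2 : K) • X + (2 : K) • ⁅N, X⁆ + ⁅N, ⁅N, X⁆⁆ ∈ L :=
    L.add_mem (L.add_mem (L.smul_mem 2 hX) (L.smul_mem 2 (L.lie_mem hNL hX))) (L.lie_mem hNL (L.lie_mem hNL hX))
  rw [← two_smul_conj_one_add_eq N X hN] at hmem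
  have := L.smul_mem (2 : K)⁻¹ hmem
  rwa [smul_smul, inv_mul_cancel₀ h2, one_smul] at this

/-! ## The transvection direction `s_{vv}` -/

/-- `s_{vv} ∘ s_{vv} = 0` for alternating `ω`. [cite: Katz1990ESDE, Ch. 1, (1.7.6) (p. 22)] -/
theorem symSq_self_mul_self {ω : BilinForm K V} (hω : ω.IsAlt) (v : V) : symSq ω v v * symSq ω v v = 0 := by
  ext z
  simp only [Module.End.mul_apply, symSq_apply, map_add, map_smul, hω v, zero_smul, add_zero, smul_zero,
    LinearMap.zero_apply]

/-- `range s_{vv} = K v` when `ω(·, v) ≠ 0` somewhere and `2 ≠ 0`. [cite: Katz1990ESDE, Ch. 1, (1.7.6) (p. 22)] -/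
theorem range_symSq_self {ω : BilinForm K V} (h2 : (2 : K) ≠ 0) (v : V) {z₀ : V} (hz₀ : ω z₀ v ≠ 0) :
    LinearMap.range (symSq ω v v) = K ∙ v := by
  apply le_antisymm
  · rintro _ ⟨z, rfl⟩
    rw [symSq_apply, ← add_smul]
    exact Submodule.smul_mem _ _ (Submodule.mem_span_singleton_self v)
  · rw [Submodule.span_singleton_le_iff_mem]
    refine ⟨((2 : K) * ω z₀ v)⁻¹ • z₀, ?_⟩
    rw [map_smul, symSq_apply, ← add_smul, ← two_mul, smul_smul, inv_mul_cancel₀ (mul_ne_zero h2 hz₀), one_smul]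

/-- **`rank s_{vv} = 1`** (`ω` non-degenerate, `v ≠ 0`, `2 ≠ 0`). [cite: Katz1990ESDE, Ch. 1, (1.7.6) (p. 22)] -/
theorem finrank_range_symSq_self {ω : BilinForm K V} (hωn : ω.Nondegenerate) (h2 : (2 : K) ≠ 0) {v : V} (hv : v ≠ 0) :
    finrank K (LinearMap.range (symSq ω v v)) = 1 := by
  obtain ⟨z₀, hz₀⟩ : ∃ z₀, ω z₀ v ≠ 0 := by
    by_contra h
    push Not at h
    exact hv (hωn.2 v h)
  rw [range_symSq_self h2 v hz₀, finrank_span_singleton hv]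

/-! ## `𝒮ℒ` is excluded for skew operators -/

/-- **A space of `ω`-skew operators is not `𝒮ℒ(M)`** as soon as `M` carries `v, w, u, u′` with `ω(v,w) = ω(u,u′) = 1`,
`ω(v,u) = ω(v,u′) = 0`: the trace-zero operator `ω(·, w) v − ω(·, u′) u` is not skew. [cite: Katz1990ESDE, Ch. 1, Thm. 1.5 (p. 11)] -/
theorem not_isSL_of_skew [FiniteDimensional K V] {ω : BilinForm K V} (hω : ω.IsAlt) {L : LieSubalgebra K (Module.End K V)}
    (hskew : ∀ X ∈ L, ∀ x y, ω (X x) y = -ω x (X y)) {v w u u' : V} (hvw : ω v w = 1) (huu : ω u u' = 1) (hvu : ω v u = 0)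
    (hvu' : ω v u' = 0) : ¬ IsSL L := by
  intro hSL
  set X : Module.End K V := (ω.flip w).smulRight v - (ω.flip u').smulRight u with hXdef
  have htr : LinearMap.trace K V X = 0 := by
    rw [hXdef, map_sub, trace_smulRight_flip, trace_smulRight_flip, hvw, huu, sub_self]
  have hX : X ∈ L := (hSL X).2 htr
  have h := hskew X hX v w
  have hXv : X v = v := by
    have hflip : ∀ a b : V, ω.flip a b = ω b a := fun _ _ => rfl
    simp only [hXdef, LinearMap.sub_apply, LinearMap.smulRight_apply, hflip, hvw, hvu', one_smul, zero_smul, sub_zero]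
  have hXw : X w = -(ω w u' • u) := by
    have hflip : ∀ a b : V, ω.flip a b = ω b a := fun _ _ => rfl
    simp only [hXdef, LinearMap.sub_apply, LinearMap.smulRight_apply, hflip, hω w, zero_smul, zero_sub]
  rw [hXv, hXw, map_neg, map_smul, smul_eq_mul, hvu, mul_zero, neg_zero, neg_zero] at h
  exact one_ne_zero (hvw ▸ h)

/-! ## Case (a) of BL -/

/-- **An irreducible semisimple `L ≤ 𝔰𝔭(M, ω)` containing a transvection direction `s_{vv}` (`v ≠ 0`) is `𝔰𝔭(M, ω)`**, over
Katz's Theorem 1.5 (named fact `Katz1990_thm15_pseudoreflection`): the unipotent pseudo-reflection `1 + s_{vv}` normalises `L`;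
of the three outcomes, `𝒮ℒ` is impossible for skew operators (witness vectors `w, u, u′`), `𝒮𝒪` is impossible next to the
invariant symplectic `ω` (Schur), and `𝒮𝒫` means `L = 𝔰𝔭(M, ω)`. `K` algebraically closed of characteristic `0`.
[cite: Katz1990ESDE, Ch. 1, Thm. 1.5 (p. 11) and (1.7.6) (p. 22)] -/
theorem eq_skewAdjoint_of_symSq_self_mem {K : Type} [Field K] [IsAlgClosed K] [CharZero K] {V : Type} [AddCommGroup V]
    [Module K V] [FiniteDimensional K V] (h15 : Katz1990_thm15_pseudoreflection) {ω : BilinForm K V} (hωn : ω.Nondegenerate)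
    (hω : ω.IsAlt) (L : LieSubalgebra K (Module.End K V)) [LieAlgebra.IsSemisimple K L] (hle : L ≤ skewAdjointLieSubalgebra ω)
    (hirr : IsIrreducibleOn L) {v : V} (hv : v ≠ 0) (hvL : symSq ω v v ∈ L)
    {w u u' : V} (hvw : ω v w = 1) (huu : ω u u' = 1) (hvu : ω v u = 0) (hvu' : ω v u' = 0) :
    L = skewAdjointLieSubalgebra ω := by
  haveI : Nontrivial V := ⟨⟨v, 0, hv⟩⟩
  have h2 : (2 : K) ≠ 0 := two_ne_zero
  have hskew : ∀ X ∈ L, ∀ x y, ω (X x) y = -ω x (X y) := by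
    intro X hX x y
    have hX' : X ∈ ω.skewAdjointSubmodule := hle hX
    rw [LinearMap.mem_skewAdjointSubmodule] at hX'
    have := hX' x y
    rwa [Pi.neg_apply, map_neg] at this
  -- the pseudo-reflection `γ = 1 + s_{vv}`
  set N := symSq ω v v with hNdef
  have hN : N * N = 0 := symSq_self_mul_self hω v
  let γ := unipotentEquiv N hN
  have hγ : finrank K (LinearMap.range ((γ : V →ₗ[K] V) - LinearMap.id)) = 1 := by
    rw [unipotentEquiv_sub_id]; exact finrank_range_symSq_self hωn h2 hv
  have hnorm : ∀ x ∈ L, (γ : V →ₗ[K] V) * x * (γ.symm : V →ₗ[K] V) ∈ L := fun x hx =>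
    conj_mem_of_sq_zero_mem h2 L hN hvL hx
  have hn : 2 ≤ finrank K V := by
    -- `v, w` are linearly independent (`ω(v, w) = 1`, `ω(v, v) = ω(w, w) = 0`)
    have hli : LinearIndependent K ![v, w] := by
      refine LinearIndependent.pair_iff.2 fun s t hst => ?_
      have h1 := congrArg (fun z => ω v z) hst
      have h2' := congrArg (fun z => ω z w) hst
      simp only [map_add, map_smul, LinearMap.add_apply, LinearMap.smul_apply, smul_eq_mul, hω v, hω w, hvw, mul_zero,
        mul_one, zero_add, add_zero, map_zero, LinearMap.zero_apply] at h1 h2'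
      exact ⟨h2', h1⟩
    simpa using hli.fintype_card_le_finrank
  rcases Katz1990_thm15_pseudoreflection.trichotomy h15 L hn inferInstance hirr γ hγ hnorm with hSL | hSO | hSP
  · exact absurd hSL (not_isSL_of_skew hω hskew hvw huu hvu hvu')
  · obtain ⟨B, hB, hBs, hBL⟩ := hSO.exists_forall_skew
    exact (not_symm_invariant_of_le_sp h2 hωn hω hle hirr hB hBs hBL).elim
  · obtain ⟨B, hB, -, hLB⟩ := hSP
    exact eq_skewAdjoint_of_eq_skewAdjoint_of_le hωn hB hle hLB hirr

end TransvectionDirection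

end Literature.Algebra.Lie
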